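import Literature.NumberTheory.ModularForms.LevelOneHeckeFunctionalEquation
import Literature.NumberTheory.ModularForms.LevelOneSimultaneousEigenforms
import Mathlib.NumberTheory.LSeries.Deriv
import Mathlib.Analysis.Complex.Convex
import HarnessLib

/-!
# Hecke's theorem for level one: the cusp-form case and the two basic examples `Δ` and `E_k` (Apostol §6.16)

Companion of `LevelOneHeckeFunctionalEquation` (Apostol, *Modular Functions and Dirichlet Series in Number Theory*,
Thm. 6.20 = Hecke 1936) instantiating the continuation `φ_f` and the completed function `Λ_f` on the two families of
level-one forms singled out in Apostol §6.13–§6.16 and Serre VII §5.5: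

* **Cusp forms** (Thm. 6.20 (a) with Thm. 6.17): for `f ∈ M_{k,0}(SL₂(ℤ))` the Dirichlet series converges absolutely for
  `σ > k/2 + 1` (Hecke's bound), `φ_f` is entire, and — by analytic continuation from `σ > k` — `φ_f(s) = Σ c(n)n^{−s}` on the
  whole half-plane `σ > k/2 + 1` (`levelOneLFunction_eq_LSeries_of_cuspForm`); `Λ_f` is entire with
  `Λ_f(k − s) = (−1)^{k/2}Λ_f(s)`.
* **Ramanujan's `Δ`** (Apostol §6.16 Example; Serre VII (84)–(85) with Prop. 14): `φ_Δ(s) = Σ τ(n)n^{−s}` for `σ > 7`,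
  `φ_Δ` entire, `Λ_Δ(12 − s) = Λ_Δ(s)` (`(−1)^{12/2} = 1`).
* **The normalized Eisenstein series** `G = c₁(E_k)⁻¹E_k = −B_k/2k + Σ σ_{k−1}(n)qⁿ` (Serre VII §5.5 Prop. 13, Apostol
  Thm. 6.16): `φ_G(s) = ζ(s)ζ(s−k+1)` for `σ > k`, so `Λ_G(s) = (2π)^{−s}Γ(s)ζ(s)ζ(s−k+1)` there, `Λ_G(k−s) = (−1)^{k/2}Λ_G(s)`,
  with simple poles at `s = 0`, `s = k` of residues `B_k/(2k)` and `(−1)^{k/2}(−B_k/(2k))` (Thm. 6.20 (b) with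
  `c(0) = −B_k/(2k)`).

## Contents (theorems only)

`levelOneLFunction_eq_LSeries_of_cuspForm`, `levelOneCompletedL_eq_of_cuspForm`, `differentiable_levelOneCompletedL_cuspForm`;
`levelOneLFunction_discriminant_eq` (`σ > 7`), `differentiable_levelOneLFunction_discriminant`,
`levelOneCompletedL_discriminant_sub` (`Λ_Δ(12 − s) = Λ_Δ(s)`), `levelOneCompletedL_discriminant_eq` (`σ > 7`);
`levelOneLFunction_inv_smul_E_eq_zeta_mul_zeta`, `levelOneCompletedL_inv_smul_E_eq`, `levelOneCompletedL_inv_smul_E_sub`,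
`levelOneCompletedL_inv_smul_E_residue_weight` / `_zero`.

## References

* [Apostol1990] T. M. Apostol, *Modular Functions and Dirichlet Series in Number Theory*, GTM 41 (1990), §6.16 Thm. 6.20,
  Example (Ramanujan's `τ`), Thm. 6.16.
* [Serre1973] J.-P. Serre, *A Course in Arithmetic*, GTM 7 (1973), Ch. VII §5.4 (84)–(85), §5.5 Props. 13–14.
-/

noncomputable section

open scoped MatrixGroups ModularForm Topology ArithmeticFunction.sigma
open Complex Filter Set ArithmeticFunction
open UpperHalfPlane hiding I

namespace Literature.NumberTheory.ModularForms

/-! ## §1 Cusp forms: `φ_f = Σ c(n)n^{−s}` on `σ > k/2 + 1` by analytic continuation -/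

section CuspForms

variable {k : ℤ} (hk : 0 < k) (g : CuspForm 𝒮ℒ k)

/-- **For a cusp form, `φ_f(s) = Σ c(n)n^{−s}` on the whole half-plane `σ > k/2 + 1`** of absolute convergence
(Thm. 6.17): both sides are holomorphic there (`φ_f` is entire by Thm. 6.20 (a); the Dirichlet series by absolute
convergence) and they agree on `σ > k` (`levelOneLFunction_eq_LSeries`), hence everywhere by analytic continuation.
[cite: Apostol1990, Thm. 6.20 (a) with Thm. 6.17] -/
theorem levelOneLFunction_eq_LSeries_of_cuspForm {s : ℂ} (hs : (k : ℝ) / 2 + 1 < s.re) :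
    levelOneLFunction hk (CuspForm.toModularFormₗ g) s = LSeries (fun n => (qExpansion 1 g).coeff n) s := by
  have hcoe : (⇑(CuspForm.toModularFormₗ g) : ℍ → ℂ) = ⇑g := rfl
  set U : Set ℂ := {z : ℂ | (k : ℝ) / 2 + 1 < z.re} with hU
  have hUo : IsOpen U := isOpen_lt continuous_const Complex.continuous_re
  have hUc : IsPreconnected U := (convex_halfSpace_re_gt ((k : ℝ) / 2 + 1)).isPreconnected
  -- `φ` is entire, the `L`-series is holomorphic on `U`
  have hφ : AnalyticOnNhd ℂ (levelOneLFunction hk (CuspForm.toModularFormₗ g)) U :=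
    ((differentiable_levelOneLFunction_cuspForm hk g).differentiableOn).analyticOnNhd hUo
  have hL : AnalyticOnNhd ℂ (LSeries fun n => (qExpansion 1 g).coeff n) U := by
    have habs : LSeries.abscissaOfAbsConv (fun n => (qExpansion 1 g).coeff n) ≤ (((k : ℝ) / 2 + 1 : ℝ) : EReal) :=
      LSeries.abscissaOfAbsConv_le_of_forall_lt_LSeriesSummable fun y hy =>
        LSeriesSummable_qExpansion_coeff_cuspForm g (by rwa [ofReal_re])
    refine (LSeries_analyticOnNhd _).mono fun z hz => ?_
    have hz' : (k : ℝ) / 2 + 1 < z.re := hz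
    exact lt_of_le_of_lt habs (EReal.coe_lt_coe_iff.mpr hz')
  -- they agree near the point `k + 1 ∈ U`
  have hz₀ : ((k : ℂ) + 1) ∈ U := by
    simp only [hU, mem_setOf_eq, add_re, intCast_re, one_re]
    have : (0 : ℝ) < k := by exact_mod_cast hk
    linarith
  have hev : levelOneLFunction hk (CuspForm.toModularFormₗ g) =ᶠ[𝓝 ((k : ℂ) + 1)]
      LSeries fun n => (qExpansion 1 g).coeff n := by
    have hVo : IsOpen {z : ℂ | (k : ℝ) < z.re} := isOpen_lt continuous_const Complex.continuous_re
    filter_upwards [hVo.mem_nhds (show (k : ℝ) < ((k : ℂ) + 1).re by simp)] with z hz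
    rw [levelOneLFunction_eq_LSeries hk _ hz, hcoe]
  exact hφ.eqOn_of_preconnected_of_eventuallyEq hL hUc hz₀ hev hs

/-- **`Λ_f(s) = (2π)^{−s}Γ(s)φ_f(s) = (2π)^{−s}Γ(s) Σ c(n)n^{−s}` for a cusp form on `σ > k/2 + 1`** (away from the poles of
`Γ`, automatic here since `σ > 1`). [cite: Apostol1990, Thm. 6.20 with Thm. 6.17] -/
theorem levelOneCompletedL_eq_of_cuspForm {s : ℂ} (hs : (k : ℝ) / 2 + 1 < s.re) :
    levelOneCompletedL hk (CuspForm.toModularFormₗ g) s =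
      (2 * Real.pi : ℂ) ^ (-s) * Gamma s * LSeries (fun n => (qExpansion 1 g).coeff n) s := by
  have hs₀ : 0 < s.re := by
    have : (0 : ℝ) < k := by exact_mod_cast hk
    linarith
  have hsm : ∀ m : ℕ, s ≠ -m := fun m h => by
    rw [h] at hs₀; simp at hs₀; linarith [Nat.cast_nonneg (α := ℝ) m]
  rw [← Gamma_mul_levelOneLFunction_eq hk _ hsm, levelOneLFunction_eq_LSeries_of_cuspForm hk g hs]

/-- **`Λ_f` is entire for a cusp form** (Thm. 6.20 (a); Serre: "`Φ_f` … is even holomorphic if `f` is a cusp form").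
[cite: Apostol1990, Thm. 6.20 (a)] [cite: Serre1973, Ch. VII §5.4 Remark 2 (84)–(85)] -/
theorem differentiable_levelOneCompletedL_cuspForm : Differentiable ℂ (levelOneCompletedL hk (CuspForm.toModularFormₗ g)) :=
  differentiable_levelOneCompletedL_of_coeff_zero hk _
    (CuspFormClass.qExpansion_coeff_zero g one_pos one_mem_strictPeriods_SL)

end CuspForms

/-! ## §2 Ramanujan's `Δ`: `φ_Δ(s) = Σ τ(n) n^{−s}`, entire, `Λ_Δ(12 − s) = Λ_Δ(s)` -/

section Delta

/-- The weight `12` is positive. [cite: Apostol1990, §6.16 Example] -/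
theorem twelve_pos' : (0 : ℤ) < 12 := by norm_num

/-- **`φ_Δ(s) = Σ_{n≥1} τ(n) n^{−s}` for `σ > 7`** (the continuation of Apostol's Example series).
[cite: Apostol1990, §6.16 Example with Thm. 6.20] -/
theorem levelOneLFunction_discriminant_eq {s : ℂ} (hs : 7 < s.re) :
    levelOneLFunction twelve_pos' (CuspForm.toModularFormₗ CuspForm.discriminant) s =
      LSeries (fun n => (ramanujanTau n : ℂ)) s := by
  rw [levelOneLFunction_eq_LSeries_of_cuspForm twelve_pos' CuspForm.discriminant (by norm_num; exact hs)]
  simp_rw [qExpansion_coeff_cuspForm_discriminant]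

/-- **`φ_Δ` is entire** (Thm. 6.20 (a): `c(0) = 0`). [cite: Apostol1990, Thm. 6.20 (a), §6.16 Example] -/
theorem differentiable_levelOneLFunction_discriminant :
    Differentiable ℂ (levelOneLFunction twelve_pos' (CuspForm.toModularFormₗ CuspForm.discriminant)) :=
  differentiable_levelOneLFunction_cuspForm twelve_pos' _

/-- **`Λ_Δ(12 − s) = Λ_Δ(s)`** (Thm. 6.20 (c) with `(−1)^{12/2} = 1`; Serre (85) `X_f(s) = (−1)^k X_f(2k − s)`, `2k = 12`).
[cite: Apostol1990, Thm. 6.20 (c)] [cite: Serre1973, Ch. VII §5.4 (85)] -/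
theorem levelOneCompletedL_discriminant_sub (s : ℂ) :
    levelOneCompletedL twelve_pos' (CuspForm.toModularFormₗ CuspForm.discriminant) (12 - s) =
      levelOneCompletedL twelve_pos' (CuspForm.toModularFormₗ CuspForm.discriminant) s := by
  have h := levelOneCompletedL_sub twelve_pos' (CuspForm.toModularFormₗ CuspForm.discriminant) s
  norm_num at h
  exact h

/-- **`Λ_Δ(s) = (2π)^{−s}Γ(s) Σ τ(n)n^{−s}` for `σ > 7`.** [cite: Apostol1990, Thm. 6.20, §6.16 Example]
[cite: Serre1973, Ch. VII §5.4 (84)] -/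
theorem levelOneCompletedL_discriminant_eq {s : ℂ} (hs : 7 < s.re) :
    levelOneCompletedL twelve_pos' (CuspForm.toModularFormₗ CuspForm.discriminant) s =
      (2 * Real.pi : ℂ) ^ (-s) * Gamma s * LSeries (fun n => (ramanujanTau n : ℂ)) s := by
  rw [levelOneCompletedL_eq_of_cuspForm twelve_pos' CuspForm.discriminant (by norm_num; exact hs)]
  simp_rw [qExpansion_coeff_cuspForm_discriminant]

/-- **`Λ_Δ` is entire.** [cite: Serre1973, Ch. VII §5.4 Remark 2] -/
theorem differentiable_levelOneCompletedL_discriminant :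
    Differentiable ℂ (levelOneCompletedL twelve_pos' (CuspForm.toModularFormₗ CuspForm.discriminant)) :=
  differentiable_levelOneCompletedL_cuspForm twelve_pos' _

end Delta

/-! ## §3 The normalized Eisenstein series: `φ_G(s) = ζ(s)ζ(s−k+1)` and the poles of `Λ_G` -/

section Eisenstein

variable {k : ℕ} (hk : 3 ≤ k) (hk2 : Even k)

/-- The weight of `E_k` (`k ≥ 3`) is positive as an integer. [cite: Serre1973, Ch. VII §5.5 Prop. 13] -/
theorem weight_pos_of_three_le (hk : 3 ≤ k) : (0 : ℤ) < (k : ℤ) := by exact_mod_cast (by omega : 0 < k)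

include hk2 in
/-- **`φ_G(s) = ζ(s)ζ(s − k + 1)` for `σ > k`**, `G = c₁(E_k)⁻¹ • E_k` the normalized Eisenstein series (its coefficients are
`σ_{k−1}(n)`; Serre Prop. 13, Hardy–Wright Thm 291). [cite: Serre1973, Ch. VII §5.5 Prop. 13] [cite: Apostol1990, Thm. 6.16 with Thm. 6.20] -/
theorem levelOneLFunction_inv_smul_E_eq_zeta_mul_zeta {s : ℂ} (hs : (k : ℝ) < s.re) :
    levelOneLFunction (weight_pos_of_three_le hk)
        (((qExpansion 1 (ModularForm.E hk)).coeff 1)⁻¹ • ModularForm.E hk : ModularForm 𝒮ℒ (k : ℤ)) s =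
      riemannZeta s * riemannZeta (s - (k - 1 : ℕ)) := by
  rw [levelOneLFunction_eq_LSeries _ _ (by exact_mod_cast hs)]
  exact LSeries_eq_zeta_mul_zeta_of_coeff_eq_sigma (by omega) (fun n hn => qExpansion_coeff_inv_smul_E hk hk2 hn) hs

include hk2 in
/-- **`Λ_G(s) = (2π)^{−s}Γ(s)ζ(s)ζ(s − k + 1)` for `σ > k`.** [cite: Serre1973, Ch. VII §5.5 Prop. 13 with §5.4 (84)] -/
theorem levelOneCompletedL_inv_smul_E_eq {s : ℂ} (hs : (k : ℝ) < s.re) :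
    levelOneCompletedL (weight_pos_of_three_le hk)
        (((qExpansion 1 (ModularForm.E hk)).coeff 1)⁻¹ • ModularForm.E hk : ModularForm 𝒮ℒ (k : ℤ)) s =
      (2 * Real.pi : ℂ) ^ (-s) * Gamma s * (riemannZeta s * riemannZeta (s - (k - 1 : ℕ))) := by
  rw [levelOneCompletedL_eq _ _ (by exact_mod_cast hs),
    LSeries_eq_zeta_mul_zeta_of_coeff_eq_sigma (by omega) (fun n hn => qExpansion_coeff_inv_smul_E hk hk2 hn) hs]

/-- **`Λ_G(k − s) = (−1)^{k/2} Λ_G(s)`** — the functional equation of `(2π)^{−s}Γ(s)ζ(s)ζ(s−k+1)` (Thm. 6.20 (c) for `G`).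
[cite: Apostol1990, Thm. 6.20 (c)] [cite: Serre1973, Ch. VII §5.4 (85)] -/
theorem levelOneCompletedL_inv_smul_E_sub (s : ℂ) :
    levelOneCompletedL (weight_pos_of_three_le hk)
        (((qExpansion 1 (ModularForm.E hk)).coeff 1)⁻¹ • ModularForm.E hk : ModularForm 𝒮ℒ (k : ℤ)) ((k : ℂ) - s) =
      (-1) ^ ((k : ℤ) / 2) * levelOneCompletedL (weight_pos_of_three_le hk)
        (((qExpansion 1 (ModularForm.E hk)).coeff 1)⁻¹ • ModularForm.E hk : ModularForm 𝒮ℒ (k : ℤ)) s := by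
  have h := levelOneCompletedL_sub (weight_pos_of_three_le hk)
    (((qExpansion 1 (ModularForm.E hk)).coeff 1)⁻¹ • ModularForm.E hk : ModularForm 𝒮ℒ (k : ℤ)) s
  simpa only [Int.cast_natCast] using h

include hk2 in
/-- **The residue of `Λ_G` at `s = k` is `(−1)^{k/2}·(−B_k/(2k))`** (Thm. 6.20 (b) with `c(0) = −B_k/(2k)`).
[cite: Apostol1990, Thm. 6.20 (b) with §6.14 Note] -/
theorem levelOneCompletedL_inv_smul_E_residue_weight :
    Tendsto (fun s : ℂ => (s - k) * levelOneCompletedL (weight_pos_of_three_le hk)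
        (((qExpansion 1 (ModularForm.E hk)).coeff 1)⁻¹ • ModularForm.E hk : ModularForm 𝒮ℒ (k : ℤ)) s)
      (nhdsWithin (k : ℂ) {(k : ℂ)}ᶜ) (nhds ((-1) ^ ((k : ℤ) / 2) * (-(bernoulli k : ℂ) / (2 * k)))) := by
  have h := levelOneCompletedL_residue_weight (weight_pos_of_three_le hk)
    (((qExpansion 1 (ModularForm.E hk)).coeff 1)⁻¹ • ModularForm.E hk : ModularForm 𝒮ℒ (k : ℤ))
  simp only [Int.cast_natCast] at h
  convert h using 3
  exact (qExpansion_coeff_zero_inv_smul_E hk hk2).symm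

include hk2 in
/-- **The residue of `Λ_G` at `s = 0` is `B_k/(2k)`** (the term `−c(0)/s`, `c(0) = −B_k/(2k)`).
[cite: Apostol1990, proof of Thm. 6.20 with §6.14 Note] -/
theorem levelOneCompletedL_inv_smul_E_residue_zero :
    Tendsto (fun s : ℂ => s * levelOneCompletedL (weight_pos_of_three_le hk)
        (((qExpansion 1 (ModularForm.E hk)).coeff 1)⁻¹ • ModularForm.E hk : ModularForm 𝒮ℒ (k : ℤ)) s)
      (nhdsWithin (0 : ℂ) {(0 : ℂ)}ᶜ) (nhds ((bernoulli k : ℂ) / (2 * k))) := by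
  have h := levelOneCompletedL_residue_zero (weight_pos_of_three_le hk)
    (((qExpansion 1 (ModularForm.E hk)).coeff 1)⁻¹ • ModularForm.E hk : ModularForm 𝒮ℒ (k : ℤ))
  convert h using 2
  rw [show (qExpansion 1 (⇑(((qExpansion 1 (ModularForm.E hk)).coeff 1)⁻¹ • ModularForm.E hk :
      ModularForm 𝒮ℒ (k : ℤ)))).coeff 0 = -(bernoulli k : ℂ) / (2 * k) from qExpansion_coeff_zero_inv_smul_E hk hk2]
  ring

/-- **`Λ_G` is holomorphic away from `0` and `k`** (its only poles). [cite: Apostol1990, Thm. 6.20 (b)] -/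
theorem differentiableAt_levelOneCompletedL_inv_smul_E {s : ℂ} (hs0 : s ≠ 0) (hsk : s ≠ k) :
    DifferentiableAt ℂ (levelOneCompletedL (weight_pos_of_three_le hk)
      (((qExpansion 1 (ModularForm.E hk)).coeff 1)⁻¹ • ModularForm.E hk : ModularForm 𝒮ℒ (k : ℤ))) s :=
  differentiableAt_levelOneCompletedL _ _ (Or.inl hs0) (Or.inl (by exact_mod_cast hsk))

end Eisenstein

end Literature.NumberTheory.ModularForms
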